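import Mathlib.Algebra.Order.BigOperators.Group.Finset
import Mathlib.Algebra.Order.Ring.Abs
import Mathlib.Analysis.Convex.Function
import Mathlib.Data.Real.Basic
import Mathlib.Order.Basic
import Mathlib.Tactic.Linarith
import Mathlib.Tactic.Positivity
import Mathlib.Tactic.Ring
import HarnessLib

/-!
# Pricing a Lagrangian over a LETTER BOX (support function of a coordinate box), and the shifted-dual
# floor of a family of programs (Bertsekas, *Nonlinear Programming*, Prop. 5.1.3, pointwise)

Topic `Literature/Computation/Certificates`; companion of `CovarianceBoxCertificate.lean` (pairwise-covariance weak duality),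
`TensorBernsteinEnclosure.lean` and `CovarianceBoxTensorFloor.lean`. It is the kernel form of the pricing step of floors **F3**
(joint pricing) and **F4** (row-coupled pricing, a constant shift of the combined dual's row multipliers per leaf) of the exact
reader `boxdual.reader` (cell hubbard-algo, seat hubbard-box-eng-3; `BOXDUAL-FORMAT.md` §8–§9). Everything is PROVED; no
definition, no named fact, no number.

Setting. A certificate reader knows, at a parameter value, a valid dual whose Lagrangian identity gives
`s + Σ_i q_i y_i ≤ obj(y)` for every FEASIBLE `y` (weak duality, pointwise: the penalty terms are nonnegative on feasible points
— this is `CovarianceBox.sum_mul_sub_cov_le_kernel`'s first step, or the cert-0 / LMI-form bound), and it knows a LETTER BOX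
`lb_i ≤ y_i ≤ ub_i` containing every feasible `y` (a-priori bounds of the problem, principal-submatrix bounds from the PSD blocks,
density pins, fixed-point bounds — all order facts about the feasible set). Then
`s + Σ_i min(lb_i q_i, ub_i q_i) ≤ obj(y)` for every feasible `y`: the infimum of a linear form over a coordinate box is attained
coordinatewise at an endpoint (`min(lb q, ub q) ≤ q y` for `y ∈ [lb, ub]`). With the symmetric box `[-B_i, B_i]` this is the
`ℓ¹` pricing `s - Σ_i B_i |q_i|` of the cert-0 formula; with `m_i = (lb_i+ub_i)/2`, `r_i = (ub_i-lb_i)/2` it is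
`s + Σ_i (m_i q_i - r_i |q_i|)`, the shape the reader encloses by tensor Bernstein coefficients
(`TensorBernstein.sub_sum_abs_ge_of_leafRepresentation`).

* `min_mul_le_mul_of_mem_Icc` — `min (lb*q) (ub*q) ≤ q*y` for `lb ≤ y ≤ ub` (any sign of `q`);
* `min_mul_eq_mid_sub_rad_abs` — `min (lb*q) (ub*q) = (lb+ub)/2 * q - (ub-lb)/2 * |q|`;
* `sum_min_mul_le_sum_mul` — the box infimum of a linear form, `Σ_i min(lb_i q_i, ub_i q_i) ≤ Σ_i q_i y_i` on the box;
* `lagrangianBoxFloor_le` — **the floor**: a pointwise Lagrangian lower bound `s + Σ q_i y_i ≤ obj y` on the feasible set plus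
  the letter box ⇒ `s + Σ_i min(lb_i q_i, ub_i q_i) ≤ obj y` for every feasible `y`;
* `lagrangianBoxFloor_le_of_forall_param` — the same uniformly over a parameter set `Θ` with a floor `m ≤ s(θ) + Σ_i min(…)(θ)`
  for all `θ ∈ Θ` (the reader certifies this last inequality by Bernstein enclosure over the tensor-weight cube): `m ≤ obj θ y`.

## Mathlib search

`Finset.sum_le_sum`, `min_le_iff`, `mul_le_mul_of_nonneg_left`, `mul_le_mul_of_nonpos_right` (`Mathlib.Algebra.Order.Ring.Unbundled.Basic`),
`abs_of_nonneg`, `abs_of_neg`. No support-function-of-a-box lemma in this elementary form was found (`lean search 'min_mul'` empty);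
certnum's `FixedDualTransfer.lean` uses the symmetric `Σ ρ_v |Δr_v|` form inline.

## References

* D. P. Bertsekas, *Nonlinear Programming*, 2nd ed., Athena Scientific 1999, §5.1.2 Prop. 5.1.3 (weak duality, pointwise).
  [cite: Bertsekas1999NonlinearProgramming, Prop. 5.1.3]
* R. T. Rockafellar, *Convex Analysis*, Princeton 1970, §13 (support functions; the support function of a box is separable).
  [cite: Rockafellar1970, §13]
-/

namespace Literature.Computation.Certificates.LetterBox

open Finset

/-- **One coordinate of the box infimum**: for `lb ≤ y ≤ ub` and any real `q`, `min (lb*q) (ub*q) ≤ q*y`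
(if `q ≥ 0` the minimum is at `lb`, else at `ub`). [cite: Rockafellar1970, §13] -/
theorem min_mul_le_mul_of_mem_Icc (lb ub q y : ℝ) (hlb : lb ≤ y) (hub : y ≤ ub) :
    min (lb * q) (ub * q) ≤ q * y := by
  rcases le_or_gt 0 q with hq | hq
  · have h : lb * q ≤ y * q := mul_le_mul_of_nonneg_right hlb hq
    calc min (lb * q) (ub * q) ≤ lb * q := min_le_left _ _
      _ ≤ y * q := h
      _ = q * y := mul_comm _ _
  · have h : ub * q ≤ y * q := mul_le_mul_of_nonpos_right hub hq.le
    calc min (lb * q) (ub * q) ≤ ub * q := min_le_right _ _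
      _ ≤ y * q := h
      _ = q * y := mul_comm _ _

/-- **Midpoint–radius form** of the coordinate infimum: `min (lb*q) (ub*q) = (lb+ub)/2 * q - (ub-lb)/2 * |q|` (for `lb ≤ ub`),
the shape `m q - r |q|` that the reader encloses by Bernstein coefficients. [cite: Rockafellar1970, §13] -/
theorem min_mul_eq_mid_sub_rad_abs (lb ub q : ℝ) (h : lb ≤ ub) :
    min (lb * q) (ub * q) = (lb + ub) / 2 * q - (ub - lb) / 2 * |q| := by
  rcases le_or_gt 0 q with hq | hq
  · rw [abs_of_nonneg hq, min_eq_left (mul_le_mul_of_nonneg_right h hq)]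
    ring
  · rw [abs_of_neg hq, min_eq_right (mul_le_mul_of_nonpos_right h hq.le)]
    ring

/-- **The box infimum of a linear form** (support function of a coordinate box is separable): for `y` in the letter box,
`Σ_i min(lb_i q_i, ub_i q_i) ≤ Σ_i q_i y_i`. [cite: Rockafellar1970, §13] -/
theorem sum_min_mul_le_sum_mul {ι : Type*} (S : Finset ι) (lb ub q y : ι → ℝ)
    (hbox : ∀ i ∈ S, lb i ≤ y i ∧ y i ≤ ub i) :
    ∑ i ∈ S, min (lb i * q i) (ub i * q i) ≤ ∑ i ∈ S, q i * y i :=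
  Finset.sum_le_sum fun i hi => min_mul_le_mul_of_mem_Icc (lb i) (ub i) (q i) (y i) (hbox i hi).1 (hbox i hi).2

/-- **Lagrangian floor priced on the letter box** (reader floors F3/F4 at one parameter value). Data: an objective `obj`,
a feasible set `F`, a letter box valid on `F` (`lb_i ≤ y_i ≤ ub_i` for feasible `y`), and a valid dual's pointwise Lagrangian
bound `s + Σ_i q_i y_i ≤ obj y` on `F` (weak duality with nonnegative penalties: Bertsekas Prop. 5.1.3 — for the reader, the
cert-0 identity of the COMBINED dual, possibly shifted by `(δλ, δκ)` with `κ + δκ ≥ 0`). Then every feasible `y` has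
`s + Σ_i min(lb_i q_i, ub_i q_i) ≤ obj y`. [cite: Bertsekas1999NonlinearProgramming, Prop. 5.1.3] -/
theorem lagrangianBoxFloor_le {Y ι : Type*} (S : Finset ι) (F : Set Y) (obj : Y → ℝ) (coord : Y → ι → ℝ)
    (lb ub : ι → ℝ) (hbox : ∀ y ∈ F, ∀ i ∈ S, lb i ≤ coord y i ∧ coord y i ≤ ub i)
    (s : ℝ) (q : ι → ℝ) (hlag : ∀ y ∈ F, s + ∑ i ∈ S, q i * coord y i ≤ obj y)
    {y : Y} (hy : y ∈ F) :
    s + ∑ i ∈ S, min (lb i * q i) (ub i * q i) ≤ obj y :=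
  le_trans (by linarith [sum_min_mul_le_sum_mul S lb ub q (coord y) (hbox y hy)]) (hlag y hy)

/-- **Uniform version over a parameter set** (the cell floor): for every `θ ∈ Θ` a valid dual gives the pointwise Lagrangian
bound with data `s θ`, `q θ`, the letter box is valid on every `F θ`, and a number `m` lies below the priced Lagrangian
`s θ + Σ_i min(lb_i q_i θ, ub_i q_i θ)` for all `θ ∈ Θ` (what the reader certifies by tensor Bernstein enclosure of the
polynomials `s(θ(x))`, `q_i(θ(x))` over the leaves of the weight cube). Then `m ≤ obj θ y` for every `θ ∈ Θ` and every
feasible `y`. [cite: Bertsekas1999NonlinearProgramming, Prop. 5.1.3] -/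
theorem lagrangianBoxFloor_le_of_forall_param {P Y ι : Type*} (Θ : Set P) (S : Finset ι) (F : P → Set Y)
    (obj : P → Y → ℝ) (coord : Y → ι → ℝ) (lb ub : ι → ℝ)
    (hbox : ∀ θ ∈ Θ, ∀ y ∈ F θ, ∀ i ∈ S, lb i ≤ coord y i ∧ coord y i ≤ ub i)
    (s : P → ℝ) (q : P → ι → ℝ) (hlag : ∀ θ ∈ Θ, ∀ y ∈ F θ, s θ + ∑ i ∈ S, q θ i * coord y i ≤ obj θ y)
    (m : ℝ) (hm : ∀ θ ∈ Θ, m ≤ s θ + ∑ i ∈ S, min (lb i * q θ i) (ub i * q θ i))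
    {θ : P} (hθ : θ ∈ Θ) {y : Y} (hy : y ∈ F θ) : m ≤ obj θ y :=
  le_trans (hm θ hθ) (lagrangianBoxFloor_le S (F θ) (obj θ) coord lb ub (hbox θ hθ) (s θ) (q θ) (hlag θ hθ) hy)

/-- **Shifted multipliers stay valid** (the F4 step, scalar bookkeeping): if a penalty `κ · g(y)` with `g ≥ 0` on feasible points is
part of a valid Lagrangian bound `s + Σ q_i y_i + κ g(y) ≤ obj y` … the reader only needs that ADDING `δ · g(y)` with
`κ + δ ≥ 0` keeps the dropped term nonnegative: `(κ + δ) g ≥ 0`. Stated as the one-line order fact it is.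
[cite: Bertsekas1999NonlinearProgramming, Prop. 5.1.3] -/
theorem shifted_penalty_nonneg (κ δ g : ℝ) (hκ : 0 ≤ κ + δ) (hg : 0 ≤ g) : 0 ≤ (κ + δ) * g :=
  mul_nonneg hκ hg

/-! ## Coordinatewise endpoint minimum on a box (floor **F6** of the reader: ONE parameter-independent dual per leaf,
certified at the leaf CORNERS)

With a dual that does not depend on the parameter, the Lagrangian floor `θ ↦ s(θ) + Σ_i min(lb_i q_i(θ), ub_i q_i(θ))` of a
multi-affine family is concave in each coordinate of `θ` separately (`s`, `q_i` affine in each coordinate; `t ↦ min(lb t, ub t)`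
concave), so its minimum over a coordinate box is attained at a corner: the reader evaluates the `2^d` corner values exactly and
quotes their minimum (`BOXDUAL-FORMAT.md` §13). The two lemmas below are that step: a coordinatewise "value ≥ min of the two
endpoint values" property propagates a bound from the corners to the whole box (induction on the set of free coordinates), and
concavity of the coordinate sections supplies the property (`ConcaveOn.ge_on_segment`). [cite: Rockafellar1970, §32 Thm 32.2] -/

/-- A concave function on `[a, b]` is bounded below on `[a, b]` by the smaller endpoint value. [cite: Rockafellar1970, §32] -/
theorem min_endpoints_le_of_concaveOn {g : ℝ → ℝ} {a b x : ℝ} (hg : ConcaveOn ℝ (Set.Icc a b) g)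
    (hax : a ≤ x) (hxb : x ≤ b) : min (g a) (g b) ≤ g x := by
  have hab : a ≤ b := hax.trans hxb
  have hseg : x ∈ segment ℝ a b := by
    rw [segment_eq_Icc hab]
    exact ⟨hax, hxb⟩
  exact hg.ge_on_segment (Set.left_mem_Icc.2 hab) (Set.right_mem_Icc.2 hab) hseg

/-- **Corner rule.** On the box `lo ≤ θ ≤ hi` (coordinatewise, `Fin d → ℝ`), if at every point of the box and along every
coordinate the value of `f` is at least the smaller of the two values obtained by moving that coordinate to an end point, then a
lower bound valid at the `2^d` corners is valid on the whole box. [cite: Rockafellar1970, §32 Thm 32.2] -/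
theorem le_of_forall_corners_le {d : ℕ} (lo hi : Fin d → ℝ) (f : (Fin d → ℝ) → ℝ) (m : ℝ)
    (h : ∀ θ : Fin d → ℝ, (∀ j, lo j ≤ θ j ∧ θ j ≤ hi j) →
      ∀ j, min (f (Function.update θ j (lo j))) (f (Function.update θ j (hi j))) ≤ f θ)
    (hc : ∀ θ : Fin d → ℝ, (∀ j, θ j = lo j ∨ θ j = hi j) → m ≤ f θ) :
    ∀ θ : Fin d → ℝ, (∀ j, lo j ≤ θ j ∧ θ j ≤ hi j) → m ≤ f θ := by
  classical
  -- Q S: the bound holds at every box point whose coordinates OUTSIDE S are already at an end point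
  suffices key : ∀ S : Finset (Fin d), ∀ θ : Fin d → ℝ, (∀ j, lo j ≤ θ j ∧ θ j ≤ hi j) →
      (∀ j, j ∉ S → (θ j = lo j ∨ θ j = hi j)) → m ≤ f θ by
    intro θ hθ
    exact key Finset.univ θ hθ (fun j hj => absurd (Finset.mem_univ j) hj)
  intro S
  induction S using Finset.induction_on with
  | empty =>
    intro θ _ hext
    exact hc θ (fun j => hext j (Finset.notMem_empty j))
  | insert j S hjS ih =>
    intro θ hθ hext
    have hlo : ∀ i, lo i ≤ (Function.update θ j (lo j)) i ∧ (Function.update θ j (lo j)) i ≤ hi i := by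
      intro i
      by_cases hij : i = j
      · subst hij
        simp only [Function.update_self]
        exact ⟨le_rfl, (hθ i).1.trans (hθ i).2⟩
      · simp only [Function.update_of_ne hij]
        exact hθ i
    have hhi : ∀ i, lo i ≤ (Function.update θ j (hi j)) i ∧ (Function.update θ j (hi j)) i ≤ hi i := by
      intro i
      by_cases hij : i = j
      · subst hij
        simp only [Function.update_self]
        exact ⟨(hθ i).1.trans (hθ i).2, le_rfl⟩
      · simp only [Function.update_of_ne hij]
        exact hθ i
    have hext_lo : ∀ i, i ∉ S → ((Function.update θ j (lo j)) i = lo i ∨ (Function.update θ j (lo j)) i = hi i) := by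
      intro i hi'
      by_cases hij : i = j
      · subst hij
        simp only [Function.update_self, true_or]
      · simp only [Function.update_of_ne hij]
        exact hext i (fun hmem => by
          rcases Finset.mem_insert.1 hmem with h' | h'
          · exact hij h'
          · exact hi' h')
    have hext_hi : ∀ i, i ∉ S → ((Function.update θ j (hi j)) i = lo i ∨ (Function.update θ j (hi j)) i = hi i) := by
      intro i hi'
      by_cases hij : i = j
      · subst hij
        simp only [Function.update_self, or_true]
      · simp only [Function.update_of_ne hij]
        exact hext i (fun hmem => by
          rcases Finset.mem_insert.1 hmem with h' | h'
          · exact hij h'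
          · exact hi' h')
    have h1 := ih _ hlo hext_lo
    have h2 := ih _ hhi hext_hi
    exact (le_min h1 h2).trans (h θ hθ j)

/-- **Corner rule from concave coordinate sections** (the reader's F6 certificate step: with a FIXED dual the Lagrangian floor
of a multi-affine family is concave in each coordinate, so the minimum of its `2^d` leaf-corner values is a floor on the whole
leaf box). [cite: Rockafellar1970, §32 Thm 32.2] -/
theorem le_of_forall_corners_le_of_coordConcave {d : ℕ} (lo hi : Fin d → ℝ) (f : (Fin d → ℝ) → ℝ) (m : ℝ)
    (hconc : ∀ θ : Fin d → ℝ, (∀ j, lo j ≤ θ j ∧ θ j ≤ hi j) →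
      ∀ j, ConcaveOn ℝ (Set.Icc (lo j) (hi j)) (fun t => f (Function.update θ j t)))
    (hc : ∀ θ : Fin d → ℝ, (∀ j, θ j = lo j ∨ θ j = hi j) → m ≤ f θ) :
    ∀ θ : Fin d → ℝ, (∀ j, lo j ≤ θ j ∧ θ j ≤ hi j) → m ≤ f θ := by
  refine le_of_forall_corners_le lo hi f m ?_ hc
  intro θ hθ j
  have key := min_endpoints_le_of_concaveOn (hconc θ hθ j) (hθ j).1 (hθ j).2
  simpa only [Function.update_eq_self] using key

/-! ### The coordinate sections of the F6 floor, explicitly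

With a fixed dual the reader's floor restricted to one coordinate `t` of the parameter (the others frozen) is
`g(t) = a + b t + Σ_{i∈S} min(lb_i (c_i + d_i t), ub_i (c_i + d_i t))` — an affine scalar part plus the letter-box
pricing of a residual that is affine in `t` (multi-affine data). Such a `g` lies above the chord of its end-point
values, hence above the smaller end-point value: this is the hypothesis `h` of `le_of_forall_corners_le` in closed form,
with no appeal to `ConcaveOn`. [cite: Rockafellar1970, §32 Thm 32.2] -/

/-- One priced letter along a segment: the letter-box pricing of an affine residual is concave in the parameter
(chord inequality with weights `1 - s`, `s`). [cite: Rockafellar1970, §32] -/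
theorem chord_le_min_mul_affine (lb ub c d p q s : ℝ) (hs0 : 0 ≤ s) (hs1 : s ≤ 1) :
    (1 - s) * min (lb * (c + d * p)) (ub * (c + d * p)) + s * min (lb * (c + d * q)) (ub * (c + d * q)) ≤
      min (lb * (c + d * ((1 - s) * p + s * q))) (ub * (c + d * ((1 - s) * p + s * q))) := by
  have h1s : 0 ≤ 1 - s := by linarith
  refine le_min ?_ ?_
  · have e1 : lb * (c + d * ((1 - s) * p + s * q)) = (1 - s) * (lb * (c + d * p)) + s * (lb * (c + d * q)) := by ring
    rw [e1]
    exact add_le_add (mul_le_mul_of_nonneg_left (min_le_left _ _) h1s) (mul_le_mul_of_nonneg_left (min_le_left _ _) hs0)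
  · have e2 : ub * (c + d * ((1 - s) * p + s * q)) = (1 - s) * (ub * (c + d * p)) + s * (ub * (c + d * q)) := by ring
    rw [e2]
    exact add_le_add (mul_le_mul_of_nonneg_left (min_le_right _ _) h1s) (mul_le_mul_of_nonneg_left (min_le_right _ _) hs0)

/-- **Section shape of the F6 floor**: `g(t) = a + b t + Σ_i min(lb_i (c_i + d_i t), ub_i (c_i + d_i t))` is bounded below
on `[p, q]` by `min (g p) (g q)`. [cite: Rockafellar1970, §32 Thm 32.2] -/
theorem min_endpoints_le_affine_add_sum_min {ι : Type*} (S : Finset ι) (a b : ℝ) (lb ub c d : ι → ℝ)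
    {p q t : ℝ} (hpt : p ≤ t) (htq : t ≤ q) :
    min (a + b * p + ∑ i ∈ S, min (lb i * (c i + d i * p)) (ub i * (c i + d i * p)))
        (a + b * q + ∑ i ∈ S, min (lb i * (c i + d i * q)) (ub i * (c i + d i * q))) ≤
      a + b * t + ∑ i ∈ S, min (lb i * (c i + d i * t)) (ub i * (c i + d i * t)) := by
  rcases eq_or_lt_of_le (hpt.trans htq) with hpq | hpq
  · -- degenerate segment: t = p = q
    have htp : t = p := le_antisymm (hpq ▸ htq) hpt
    rw [htp]
    exact min_le_left _ _
  · set s : ℝ := (t - p) / (q - p) with hs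
    have hqp : 0 < q - p := by linarith
    have hs0 : 0 ≤ s := div_nonneg (by linarith) hqp.le
    have hs1 : s ≤ 1 := by
      rw [hs, div_le_one hqp]
      linarith
    have ht : t = (1 - s) * p + s * q := by
      rw [hs]
      field_simp
      ring
    -- chord inequality term by term, then summed
    have hsum : (1 - s) * (∑ i ∈ S, min (lb i * (c i + d i * p)) (ub i * (c i + d i * p))) +
        s * (∑ i ∈ S, min (lb i * (c i + d i * q)) (ub i * (c i + d i * q))) ≤
        ∑ i ∈ S, min (lb i * (c i + d i * t)) (ub i * (c i + d i * t)) := by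
      rw [Finset.mul_sum, Finset.mul_sum, ← Finset.sum_add_distrib]
      refine Finset.sum_le_sum (fun i _ => ?_)
      have key := chord_le_min_mul_affine (lb i) (ub i) (c i) (d i) p q s hs0 hs1
      rw [← ht] at key
      exact key
    have haff : a + b * t = (1 - s) * (a + b * p) + s * (a + b * q) := by
      rw [ht]; ring
    -- convex combination of the end-point values is at least their minimum
    have hmin : min (a + b * p + ∑ i ∈ S, min (lb i * (c i + d i * p)) (ub i * (c i + d i * p)))
        (a + b * q + ∑ i ∈ S, min (lb i * (c i + d i * q)) (ub i * (c i + d i * q))) ≤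
        (1 - s) * (a + b * p + ∑ i ∈ S, min (lb i * (c i + d i * p)) (ub i * (c i + d i * p))) +
        s * (a + b * q + ∑ i ∈ S, min (lb i * (c i + d i * q)) (ub i * (c i + d i * q))) := by
      set gp := a + b * p + ∑ i ∈ S, min (lb i * (c i + d i * p)) (ub i * (c i + d i * p))
      set gq := a + b * q + ∑ i ∈ S, min (lb i * (c i + d i * q)) (ub i * (c i + d i * q))
      have h1 : (1 - s) * min gp gq ≤ (1 - s) * gp := mul_le_mul_of_nonneg_left (min_le_left _ _) (by linarith)
      have h2 : s * min gp gq ≤ s * gq := mul_le_mul_of_nonneg_left (min_le_right _ _) hs0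
      linarith
    linarith

/-- **Corner rule for floors with affine-min coordinate sections** (the F6 certificate step in closed form): if along
every coordinate through every point of the box the function has the shape of `min_endpoints_le_affine_add_sum_min`
(some `a, b, c_i, d_i` depending on the frozen coordinates), then a bound valid at the `2^d` corners is valid on the box.
[cite: Rockafellar1970, §32 Thm 32.2] -/
theorem le_of_forall_corners_le_of_affineMinSections {d : ℕ} {ι : Type*} (S : Finset ι) (lb ub : ι → ℝ)
    (lo hi : Fin d → ℝ) (f : (Fin d → ℝ) → ℝ) (m : ℝ)
    (hshape : ∀ θ : Fin d → ℝ, (∀ j, lo j ≤ θ j ∧ θ j ≤ hi j) → ∀ j, ∃ a b : ℝ, ∃ c e : ι → ℝ,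
      ∀ t : ℝ, f (Function.update θ j t) = a + b * t + ∑ i ∈ S, min (lb i * (c i + e i * t)) (ub i * (c i + e i * t)))
    (hc : ∀ θ : Fin d → ℝ, (∀ j, θ j = lo j ∨ θ j = hi j) → m ≤ f θ) :
    ∀ θ : Fin d → ℝ, (∀ j, lo j ≤ θ j ∧ θ j ≤ hi j) → m ≤ f θ := by
  refine le_of_forall_corners_le lo hi f m ?_ hc
  intro θ hθ j
  obtain ⟨a, b, c, e, hf⟩ := hshape θ hθ j
  have key := min_endpoints_le_affine_add_sum_min S a b lb ub c e (hθ j).1 (hθ j).2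
  rw [← hf (lo j), ← hf (hi j), ← hf (θ j), Function.update_eq_self] at key
  exact key

/-! ## Ceilings: the corner rule for coordinatewise CONVEX functions, and the sensitivity of a MAX certificate to its
parameter-dependent rows (reader `BOXDUAL-FORMAT.md` §16 cap-rhs override, §18 single-anchor transport)

Mirror images of the F6 floor lemmas for UPPER bounds. A MAX program certified at an anchor by a dual with multiplier `κ ≥ 0` on
its one cap row `h m ≤ u` and multipliers `λ_σ` on affine-rhs equality rows `n_σ m = ν_σ` satisfies, for every point `m` of the
(parameter-independent) relaxation class, the Lagrangian inequality `obj m ≤ C + κ (h m - u) + Σ_σ λ_σ (n_σ m - ν_σ)` (weak duality,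
pointwise). If at another parameter value the same class point obeys `h m ≤ u + Δ` and `n_σ m = ν_σ + δ_σ`, the certificate still
bounds it: `obj m ≤ C + κ Δ + Σ_σ λ_σ δ_σ` — exact, any signs of `Δ`, `δ_σ` (`Δ < 0` is the §16 tightening, `Δ > 0` the §18 transport).
The resulting ceiling, as a function of the parameter, is coordinatewise convex in the reader's use, so its maximum over a box sits at
a corner: `le_of_forall_corners_ge_of_coordConvex`. [cite: Bertsekas1999NonlinearProgramming, Prop. 5.1.3] -/

/-- **Sensitivity of a MAX certificate** (pointwise weak duality with ONE inequality row of multiplier `κ ≥ 0` and finitely many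
equality rows): if `obj m ≤ C + κ (h m - u) + Σ_σ λ_σ (n_σ m - ν_σ)` for the class point `m`, and `h m ≤ u + Δ`, `n_σ m = ν_σ + δ_σ`,
then `obj m ≤ C + κ Δ + Σ_σ λ_σ δ_σ`. [cite: Bertsekas1999NonlinearProgramming, Prop. 5.1.3] -/
theorem ceiling_of_lagrangian_rows {Y ι : Type*} (S : Finset ι) (obj h : Y → ℝ) (n : ι → Y → ℝ)
    (C κ u Δ : ℝ) (lam ν δ : ι → ℝ) (hκ : 0 ≤ κ) (m : Y)
    (hlag : obj m ≤ C + κ * (h m - u) + ∑ i ∈ S, lam i * (n i m - ν i))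
    (hcap : h m ≤ u + Δ) (heq : ∀ i ∈ S, n i m = ν i + δ i) :
    obj m ≤ C + κ * Δ + ∑ i ∈ S, lam i * δ i := by
  have h1 : κ * (h m - u) ≤ κ * Δ := by
    have : h m - u ≤ Δ := by linarith
    exact mul_le_mul_of_nonneg_left this hκ
  have h2 : ∑ i ∈ S, lam i * (n i m - ν i) = ∑ i ∈ S, lam i * δ i := by
    refine Finset.sum_congr rfl ?_
    intro i hi
    rw [heq i hi]
    ring
  linarith [h1, h2]

/-- The same with the equality rows priced by absolute values (unknown signs of the multipliers or of the rhs shifts):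
`obj m ≤ C + κ Δ + Σ_σ |λ_σ| |δ_σ|`. [cite: Bertsekas1999NonlinearProgramming, Prop. 5.1.3] -/
theorem ceiling_of_lagrangian_rows_abs {Y ι : Type*} (S : Finset ι) (obj h : Y → ℝ) (n : ι → Y → ℝ)
    (C κ u Δ : ℝ) (lam ν δ : ι → ℝ) (hκ : 0 ≤ κ) (m : Y)
    (hlag : obj m ≤ C + κ * (h m - u) + ∑ i ∈ S, lam i * (n i m - ν i))
    (hcap : h m ≤ u + Δ) (heq : ∀ i ∈ S, n i m = ν i + δ i) :
    obj m ≤ C + κ * Δ + ∑ i ∈ S, |lam i| * |δ i| := by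
  have h0 := ceiling_of_lagrangian_rows S obj h n C κ u Δ lam ν δ hκ m hlag hcap heq
  have h3 : ∑ i ∈ S, lam i * δ i ≤ ∑ i ∈ S, |lam i| * |δ i| := by
    refine Finset.sum_le_sum ?_
    intro i _
    rw [← abs_mul]
    exact le_abs_self _
  linarith

/-- **The transported cap slack**: if `h₀ m = h m + r m` (the anchor row = the row at the new parameter plus a remainder that is
a linear form in finitely many coordinates of `m`), `h m ≤ cap` and the coordinates lie in a letter box, then
`h₀ m ≤ cap + Σ_i max(lb_i q_i, ub_i q_i)` — the support function of the box, coordinatewise (`-min(lb(-q), ub(-q)) = max(lb q, ub q)`).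
[cite: Rockafellar1970, §13] -/
theorem anchorRow_le_cap_add_sum_max {Y ι : Type*} (S : Finset ι) (h₀ h : Y → ℝ) (coord : Y → ι → ℝ)
    (q lb ub : ι → ℝ) (cap : ℝ) (m : Y)
    (hsplit : h₀ m = h m + ∑ i ∈ S, q i * coord m i) (hcap : h m ≤ cap)
    (hbox : ∀ i ∈ S, lb i ≤ coord m i ∧ coord m i ≤ ub i) :
    h₀ m ≤ cap + ∑ i ∈ S, max (lb i * q i) (ub i * q i) := by
  have hsum : ∑ i ∈ S, q i * coord m i ≤ ∑ i ∈ S, max (lb i * q i) (ub i * q i) := by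
    refine Finset.sum_le_sum ?_
    intro i hi
    obtain ⟨hl, hu⟩ := hbox i hi
    rcases le_total 0 (q i) with hq | hq
    · have : q i * coord m i ≤ ub i * q i := by nlinarith
      exact this.trans (le_max_right _ _)
    · have : q i * coord m i ≤ lb i * q i := by nlinarith
      exact this.trans (le_max_left _ _)
  linarith

/-- **Corner rule for ceilings**: on the box `lo ≤ θ ≤ hi`, a function that is CONVEX along every coordinate section is bounded
above on the whole box by any bound valid at the `2^d` corners (apply `le_of_forall_corners_le_of_coordConcave` to `-f`).
[cite: Rockafellar1970, §32 Thm 32.2] -/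
theorem le_of_forall_corners_ge_of_coordConvex {d : ℕ} (lo hi : Fin d → ℝ) (f : (Fin d → ℝ) → ℝ) (M : ℝ)
    (hconv : ∀ θ : Fin d → ℝ, (∀ j, lo j ≤ θ j ∧ θ j ≤ hi j) →
      ∀ j, ConvexOn ℝ (Set.Icc (lo j) (hi j)) (fun t => f (Function.update θ j t)))
    (hc : ∀ θ : Fin d → ℝ, (∀ j, θ j = lo j ∨ θ j = hi j) → f θ ≤ M) :
    ∀ θ : Fin d → ℝ, (∀ j, lo j ≤ θ j ∧ θ j ≤ hi j) → f θ ≤ M := by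
  have key := le_of_forall_corners_le_of_coordConcave lo hi (fun θ => -f θ) (-M)
    (fun θ hθ j => (hconv θ hθ j).neg) (fun θ hθ => neg_le_neg (hc θ hθ))
  intro θ hθ
  have := key θ hθ
  linarith

end Literature.Computation.Certificates.LetterBox
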